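import Literature.Analysis.ValidatedNumerics.TaylorModelTangentProgram
import Literature.Analysis.ValidatedNumerics.UnivariateIntervalNewton
import HarnessLib

/-!
# Kernel-checked zero certificates for straight-line programs: exclusion leaves, interval-Newton leaves,
# exact zero counts on an interval, and inverse values of a monotone integral

Trunk T-ANA (Analysis/ValidatedNumerics); namespace `Literature.Analysis.ValidatedNumerics.PolyMP`.
Sequel of `TaylorModelTangentProgram.lean` (the tangent program `T.deriv p` of a program `p : GProg M` of a
statement family `M : OpModel`, `F : OpSem M`, `T : OpTangent M F`, with the kernel-checked guard
`T.guardCheckP` under which `∀ t ∈ [c − h, c + h], HasDerivAt (P(ps; ·)) (Ṗ(ps; t)) t`,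
`hasDerivAt_of_guardCheckP`) and of `UnivariateIntervalNewton.lean` (the interval Newton operator
`N(X) = m − f(m)/F′(X)` as the exact range `IntervalNewton.newtonSet m (f m) D`, with the PROVED enclosure /
exclusion / uniqueness / Hansen–Moore existence theorems, in particular
`IntervalNewton.existsUnique_zero_of_newtonSet_subset`: `0 ∉ F′(X)`, `m ∈ X`, `N(X) ⊆ X` ⇒ exactly one zero in
`X`, and it lies in `N(X)`).  This module COMPOSES the two into certificates decided by `decide +kernel`,
uniformly over a parameter box `B` (`BoxMem ps B`), for the function `t ↦ P(ps; t) = F.toFunP p ps t` denoted by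
a program of ANY family of the lane (`SOp`: polynomials, `exp`, `log`, `1/u`, `√u`, …; `TOp`: `+ sin, cos`;
`AOp`: `+ arctan`):

* Part A — the interval data read off a Taylor model: the centre-value enclosure `centreI` / `mem_centreI`
  (the model at half-width `0` is a point evaluation), the magnitude bounds behind the Newton radius
  (`newtonRad`: `|f(m)/d| ≤ max(|Y̲|, |Ȳ|) / min(|D̲|, |D̄|)` for `f(m)·S ∈ [Y̲, Ȳ]`, `d·S ∈ [D̲, D̄] ∌ 0` — the
  symmetric hull of the interval quotient `f(m)/F′(X)`), and `newtonSet m (f m) F′(X) ⊆ [m − r, m + r]`.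
* Part B — the two LEAF certificates on `X = [c − h, c + h]` and their soundness: the EXCLUSION leaf
  `M.exclLeafCheck` (model of `p` on `X` accepted and `nonvanishing`) ⇒ `∀ t ∈ X, P(ps; t) ≠ 0`
  (`forall_ne_zero_of_exclLeafCheck`); the NEWTON leaf `T.newtonLeafCheck` (point model of `p` at `c`, model of
  the tangent program `T.deriv p` on `X` with `0 ∉ [D̲, D̄]`, the guard certificate of `p` on `X`, `r < h`, and the
  claimed enclosure `[zlo, zhi]` with `c − h < zlo ≤ c − r`, `c + r ≤ zhi < c + h`) ⇒ EXACTLY ONE zero of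
  `P(ps; ·)` in `X`, lying in `[zlo, zhi] ⊂ (c − h, c + h)` (`existsUnique_zero_of_newtonLeafCheck`, from
  `existsUnique_zero_of_newtonSet_subset` — nothing of the interval Newton theory is re-proved here).
* Part C — the ZERO-COUNT certificate `T.zerosCheck prm S p B a b L`: a nonempty list of leaves `L : List ZLeaf`
  tiling `[a, b]` in order (`tiles`), each an exclusion or a Newton leaf that passes; soundness
  `zeros_of_zerosCheck`: the zero set of `P(ps; ·)` on `[a, b]` IS a strictly increasing list `zs`, one zero per
  Newton leaf, each inside its claimed enclosure (`List.Forall₂`) — the predicate `ZClaim`, with `ZClaim.append`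
  (segment certificates `[a, m]`, `[m, b]` checked separately glue, should one kernel call be too big),
  `ZClaim.ncard_eq`, `ZClaim.forall_ne_zero`, `ZClaim.existsUnique`, `ZClaim.forall₂_mem`; corollaries
  `ncard_zeros_of_zerosCheck` (exactly `|zEncls L|` zeros), `forall_ne_zero_of_zerosCheck` (no Newton leaf: no
  zero), and `existsUnique_zero_of_zerosCheck` (one Newton leaf: `∃!` with enclosure).
* Part D — INVERSE VALUES OF A MONOTONE INTEGRAL (the slope form of the interval Newton test, derivative-free):
  for `G(x) = ∫_A^x P(ps; t) dt` with `P(ps; ·) > 0` on `[A, B]` (positivity leaves), `G(c)·S ∈ [G̲, Ḡ]` from plain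
  quadrature leaves tiling `[A, c]` (`QLeaf`, `M.qLeafCheck`, `fsegOK_of_qLeavesCheck`), and `P(ps; ·) ≥ D̲/S > 0`
  on `[c − h, c + h]` from the model there, the radius `r = max(|G̲ − yS|, |Ḡ − yS|)/D̲ ≤ h` certifies
  `∃! x ∈ [A, B], G(x) = y`, with `x ∈ [zlo, zhi] ⊇ [c − r, c + r]` (`M.invCertCheck`,
  `existsUnique_integral_eq_of_invCertCheck`; the real lemma `existsUnique_primitive_eq` is proved here from
  integral monotonicity, the intermediate value theorem and strict monotonicity of `G` — no `HasDerivAt` of `G` is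
  needed, so no continuity of the integrand is assumed).
* Part E — certificate generation by `#eval` (untrusted, PROPOSAL only; every leaf is re-checked by the kernel):
  point values `M.pointVal`, sign-change scan and bisection `M.scanCells` / `M.bisectRoot`, adaptive exclusion
  tiling `M.exclAdapt` / `M.exclGap`, Newton leaves `T.newtonLeafOf`, the assembled proposal `T.zerosGen`
  (`zerosGenFrom`); for Part D the positivity tiling `M.posAdapt`, plain quadrature leaves and tiling `M.qLeafOf` /
  `M.quadAdapt` / `M.quadVal`, the location of `c` by Newton steps on the proposals `M.invLocate`, and the
  assembled proposal `M.invGen : … → InvCert × Bool`.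

Worked end to end (scratch kept OUT of the tree, `Certquad.ScratchZero`; `S = 2⁶⁰`, truncation degree `12`, one
`decide +kernel` per certificate, the four certificates and their corollaries checked together in under a minute
on the farm): `cos x = x` has exactly one solution in `[0, 1]`, enclosed to width `1.9·10⁻¹⁶` (trig family; three
leaves); `sin x − x cos x` (`tan x = x`) has exactly two zeros in `[1, 8]` (`Set.ncard = 2`), each enclosed to width
`< 7·10⁻¹⁶` (tangent program of 37 statements on the two Newton leaves); `t⁵ − 3t + 1` has exactly three zeros in
`[−2, 2]`, each enclosed to width `< 10⁻¹⁷`; the unique `x ∈ [0, 2]` with `∫₀ˣ e^{−t²} dt = 1/2` is enclosed to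
width `4.3·10⁻¹⁵` (Part D: two quadrature leaves, four positivity leaves); and two refusals (`= false` by the
kernel): an exclusion leaf straddling a zero, a Newton leaf containing two zeros and a critical point.

Honest framing.  These are shared numerical engines serving client cells; rigour lives in the verifiers (the
soundness theorems below, whose hypotheses are Boolean certificates decided by the kernel); every published number
belongs to a client cell's ledger, not to this module.  ANCHOR / nearest in-tree relatives, deliberately composed
or left unbridged: `UnivariateIntervalNewton.lean` (the operator and its theorems over `ℝ` — USED here, Part B);
`CodeListZeroSearchCertificate.lean` / `CodeListKrawczykCertificate.lean` (exhaustive zero SEARCH for expression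
trees `FExpr n` over boxes of `ℝⁿ` with machine-interval evaluation, Krawczyk existence/uniqueness and exclusion,
`zeroCount_sound` — a different function representation (trees over box variables, no `arctan`, no parameter
boxes as here, no Taylor models) and not bridged; the present module is the univariate Taylor-model / straight-line
program counterpart and adds the integral-inverse certificates of Part D, which have no relative in the tree);
`SignChangeRootIsolation.lean` (sign changes of exactly represented functions).  Deliberately NOT here: zeros of
even multiplicity / tangential zeros (no exclusion or Newton leaf can certify them; the generator reports failure),
zeros at the endpoints `a`, `b` (a Newton leaf needs the zero in its interior), systems / several variables
(see the Krawczyk files), the decreasing case of Part D (negate the program: `SOp.neg`), and any floating-point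
arithmetic (all data are exact rationals and scaled integers).
Problem-independent; no facts, no axioms; all certificate data computable over `ℚ` and `ℤ`.

References: [cite: Moore1979, Sect. 5.2 (5.14)–(5.16)]; [cite: Moore1979, Sect. 5.2 Thm 5.5–5.6];
[cite: Moore1979, Sect. 2.2 (2.16)–(2.21)]; [cite: AlefeldMayer2000, Sect. 3 Theorem 5]; [cite: AlefeldMayer2000, Sect. 4];
[cite: Kearfott1987, Sect. 1]; [cite: MakinoBerz2003, Algorithm 2]; [cite: MahboubiMelquiondSibutpinote2016, Sect. 3.2 Lemma 3];
[cite: MahboubiMelquiondSibutpinote2016, Sect. 3.3]; [cite: MahboubiMelquiondSibutpinote2016, Sect. 4.1];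
[cite: GriewankWalther2008, Sect. 3.1 Table 3.4].
-/

open MeasureTheory intervalIntegral Set

namespace Literature.Analysis.ValidatedNumerics

namespace PolyMP

open Literature.Analysis.ValidatedNumerics.NumericsMP
open Literature.Analysis.ValidatedNumerics.ExpPoly (Poly)
open Literature.Analysis.ValidatedNumerics.ExpPoly
open Literature.Analysis.ValidatedNumerics.IntervalNewton

/-! ### Part A. Interval data read off a Taylor model; the Newton radius -/

/-- **The centre-value enclosure** read off a Taylor model of `u ↦ f(c + u)`: its constant-coefficient interval
(`[0, 0]` for the empty model), an enclosure of `f(c)·S`; with half-width `0` the model is a point evaluation in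
scaled-integer interval arithmetic. [cite: MakinoBerz2003, Algorithm 2] -/
def centreI : IPoly → MI
  | [] => ⟨0, 0⟩
  | I :: _ => I

/-- Soundness of `centreI`: `f(0)·S ∈ centreI P`. [cite: MakinoBerz2003, Algorithm 2] -/
theorem mem_centreI {S : ℕ} {h : ℚ} (h0 : 0 ≤ h) {f : ℝ → ℝ} {P : IPoly} (hf : TMem S h f P) :
    MI.mem S (f 0) (centreI P) := by
  have h0' : |(0 : ℝ)| ≤ (h : ℝ) := by rw [abs_zero]; exact_mod_cast h0
  obtain ⟨as, has, ef⟩ := hf 0 h0'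
  match as, P, has with
  | [], [], _ =>
      rw [evalR_nil] at ef
      simp [centreI, MI.mem, ef]
  | a :: as, I :: T, List.Forall₂.cons ha _ =>
      rw [evalR_cons, zero_mul, add_zero] at ef
      rw [centreI, ef]
      exact ha

/-- `|y|·S ≤ max(|I̲|, |Ī|)` for `y·S ∈ I`. [cite: Moore1979, Sect. 2.2 (2.16)–(2.21)] -/
theorem abs_mul_le_of_mem {S : ℕ} {y : ℝ} {I : MI} (hy : MI.mem S y I) :
    |y| * S ≤ ((max |I.lo| |I.hi| : ℤ) : ℝ) := by
  obtain ⟨h1, h2⟩ := hy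
  have hS : (0 : ℝ) ≤ S := by positivity
  rw [← abs_of_nonneg hS, ← abs_mul]
  push_cast
  rcases le_total 0 (y * S) with h | h
  · rw [abs_of_nonneg h]
    exact (h2.trans (le_abs_self _)).trans (le_max_right _ _)
  · rw [abs_of_nonpos h]
    exact ((neg_le_neg h1).trans (neg_le_abs _)).trans (le_max_left _ _)

/-- `min(|D̲|, |D̄|) ≤ |d|·S` for `d·S ∈ [D̲, D̄]` with `0 < D̲` or `D̄ < 0` (the denominator interval excludes
zero). [cite: Moore1979, Sect. 2.2 (2.16)–(2.21)] -/
theorem le_abs_mul_of_mem {S : ℕ} {d : ℝ} {Dl Du : ℤ} (h1 : (Dl : ℝ) ≤ d * S) (h2 : d * S ≤ Du)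
    (hs : 0 < Dl ∨ Du < 0) : ((min |Dl| |Du| : ℤ) : ℝ) ≤ |d| * S := by
  have hS : (0 : ℝ) ≤ S := by positivity
  rw [← abs_of_nonneg hS, ← abs_mul]
  push_cast
  rcases hs with hs | hs
  · have hDl : (0 : ℝ) < Dl := by exact_mod_cast hs
    calc min |(Dl : ℝ)| |(Du : ℝ)| ≤ |(Dl : ℝ)| := min_le_left _ _
      _ = Dl := abs_of_pos hDl
      _ ≤ d * S := h1
      _ ≤ |d * S| := le_abs_self _
  · have hDu : (Du : ℝ) < 0 := by exact_mod_cast hs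
    calc min |(Dl : ℝ)| |(Du : ℝ)| ≤ |(Du : ℝ)| := min_le_right _ _
      _ = -Du := abs_of_neg hDu
      _ ≤ -(d * S) := neg_le_neg h2
      _ ≤ |d * S| := neg_le_abs _

/-- **The Newton radius**: `max(|Y̲|, |Ȳ|) / min(|D̲|, |D̄|)`, a bound for `|f(m)/d|` over `f(m)·S ∈ [Y̲, Ȳ]` and
`d·S ∈ [D̲, D̄] ∌ 0` — the half-width of the symmetric hull `[m − r, m + r] ⊇ N(X) = m − f(m)/F′(X)` of the interval
quotient. [cite: Moore1979, Sect. 5.2 (5.14)–(5.16)] [cite: Moore1979, Sect. 2.2 (2.16)–(2.21)] -/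
def newtonRad (Y : MI) (Dl Du : ℤ) : ℚ :=
  ((max |Y.lo| |Y.hi| : ℤ) : ℚ) / ((min |Dl| |Du| : ℤ) : ℚ)

/-- **`N(X) ⊆ [m − r, m + r]`**: the Newton image lies in the symmetric hull when `|f(m)|·S ≤ Yb`,
`m₀ ≤ |d|·S` on the derivative enclosure, and `Yb ≤ r·m₀`. [cite: Moore1979, Sect. 5.2 (5.14)–(5.16)] -/
theorem newtonSet_subset_Icc {m fm dl du Yb m0 r : ℝ} {S : ℕ} (hY : |fm| * S ≤ Yb) (hm0 : 0 < m0)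
    (hD : ∀ d ∈ Icc dl du, m0 ≤ |d| * S) (hr : Yb ≤ r * m0) :
    newtonSet m fm (Icc dl du) ⊆ Icc (m - r) (m + r) := by
  intro x hx
  obtain ⟨d, hd, rfl⟩ := mem_newtonSet.1 hx
  have hdm := hD d hd
  have hdpos : 0 < |d| := by
    rcases (abs_nonneg d).lt_or_eq with h | h
    · exact h
    · rw [← h, zero_mul] at hdm; linarith
  have hd0 : d ≠ 0 := abs_pos.1 hdpos
  have hq : |fm / d| * m0 ≤ Yb := by
    calc |fm / d| * m0 ≤ |fm / d| * (|d| * S) := mul_le_mul_of_nonneg_left hdm (abs_nonneg _)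
      _ = |fm| * S := by rw [abs_div, div_mul_eq_mul_div, div_eq_iff (ne_of_gt hdpos)]; ring
      _ ≤ Yb := hY
  have hq' : |fm / d| ≤ r := le_of_mul_le_mul_right (hq.trans hr) hm0
  obtain ⟨q1, q2⟩ := abs_le.1 hq'
  exact ⟨by linarith, by linarith⟩

/-! ### Part B. Leaves: exclusion and interval Newton on `[c − h, c + h]` -/

namespace OpModel

variable (M : OpModel)

/-- **The exclusion-leaf certificate** on `[c − h, c + h]`: `0 < S`, `0 < h`, the model of `p` accepted, and it
certifies non-vanishing (scaled lower bound positive or upper bound negative: `0 ∉ F(X)`).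
[cite: Moore1979, Sect. 5.2 Thm 5.5–5.6] [cite: MakinoBerz2003, Algorithm 2] -/
def exclLeafCheck (prm : M.Prm) (S : ℕ) (p : GProg M) (B : PBox) (c h : ℚ) (cs : List (List ℤ × ℕ)) : Bool :=
  let W := M.pmodelP prm S h c p B cs
  decide (0 < S) && decide (0 < h) && W.2 && nonvanishing S h W.1

/-- **The centre value** `f(c)·S ∈ centreI` of the POINT model (half-width `0`) of `p` at `c`, with its flag.
[cite: MakinoBerz2003, Algorithm 2] -/
def pointI (prm : M.Prm) (S : ℕ) (p : GProg M) (B : PBox) (c : ℚ) (cs : List (List ℤ × ℕ)) : MI × Bool :=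
  let W := M.pmodelP prm S 0 c p B cs
  (centreI W.1, W.2)

end OpModel

namespace OpSem

variable {M : OpModel} (F : OpSem M)

/-- [folklore] -/
private theorem measurable_getReg_consZ {f : ℝ → ℝ} {fs : List (ℝ → ℝ)} (hf : Measurable f)
    (hfs : ∀ i, Measurable (getReg (fun _ => (0 : ℝ)) fs i)) :
    ∀ i, Measurable (getReg (fun _ => (0 : ℝ)) (f :: fs) i)
  | 0 => by simpa using hf
  | i + 1 => by simpa using hfs i

/-- [folklore] -/
private theorem measurable_runFZ : ∀ (p : GProg M) (fs : List (ℝ → ℝ)),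
    (∀ i, Measurable (getReg (fun _ => (0 : ℝ)) fs i)) →
      ∀ i, Measurable (getReg (fun _ => (0 : ℝ)) (F.runF p fs) i)
  | [], fs, hfs => by simpa [runF] using hfs
  | op :: p, fs, hfs => by
      rw [runF]
      exact measurable_runFZ p _ (measurable_getReg_consZ (F.measurable_evalF hfs op) hfs)

/-- [folklore] -/
private theorem measurable_constStackZ : ∀ (ps : List ℝ) (i : ℕ),
    Measurable (getReg (fun _ => (0 : ℝ)) (constStack ps) i)
  | [], i => by rw [constStack, List.map_nil, getReg_nil]; exact measurable_const
  | c :: ps, 0 => by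
      simp only [constStack, List.map_cons, getReg_cons_zero]
      exact measurable_const
  | c :: ps, i + 1 => by simpa [constStack] using measurable_constStackZ ps i

/-- The function denoted by a program with parameters is measurable.
[cite: MahboubiMelquiondSibutpinote2016, Sect. 4.1] -/
theorem measurable_toFunPZ (p : GProg M) (ps : List ℝ) : Measurable (F.toFunP p ps) := by
  unfold toFunP
  exact F.measurable_runFZ p (constStack ps) (measurable_constStackZ ps) 0

/-- **Soundness of the exclusion leaf**: no zero of `P(ps; ·)` on `[c − h, c + h]`, for every parameter vector of
the box. [cite: Moore1979, Sect. 5.2 Thm 5.5–5.6] [cite: MakinoBerz2003, Algorithm 2] -/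
theorem forall_ne_zero_of_exclLeafCheck {prm : M.Prm} {S : ℕ} {p : GProg M} {B : PBox} {c h : ℚ}
    {cs : List (List ℤ × ℕ)} (hc : M.exclLeafCheck prm S p B c h cs = true) {ps : List ℝ} (hB : BoxMem ps B) :
    ∀ t ∈ Icc ((c : ℝ) - h) ((c : ℝ) + h), F.toFunP p ps t ≠ 0 := by
  unfold OpModel.exclLeafCheck at hc
  simp only [Bool.and_eq_true, decide_eq_true_eq] at hc
  obtain ⟨⟨⟨hS, h0⟩, hok⟩, hnv⟩ := hc
  intro t ht
  have hW := F.tmem_pmodelP prm hS h0.le c p hB cs hok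
  have hu : |t - c| ≤ (h : ℝ) := abs_le.2 ⟨by linarith [ht.1], by linarith [ht.2]⟩
  have h1 := ne_zero_of_nonvanishing h0.le hW hnv hu
  have e : (c : ℝ) + (t - c) = t := by ring
  rwa [e] at h1

/-- **Soundness of the point value**: `P(ps; c)·S ∈ pointI`. [cite: MakinoBerz2003, Algorithm 2] -/
theorem mem_pointI {prm : M.Prm} {S : ℕ} (hS : 0 < S) {p : GProg M} {B : PBox} {c : ℚ}
    {cs : List (List ℤ × ℕ)} (hok : (M.pointI prm S p B c cs).2 = true) {ps : List ℝ} (hB : BoxMem ps B) :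
    MI.mem S (F.toFunP p ps c) (M.pointI prm S p B c cs).1 := by
  unfold OpModel.pointI at hok ⊢
  have hW := F.tmem_pmodelP prm hS le_rfl c p hB cs hok
  have h1 := mem_centreI le_rfl hW
  simpa using h1

end OpSem

namespace OpTangentCore

variable {M : OpModel} (T : OpTangentCore M)

/-- **The Newton-leaf certificate** on `X = [c − h, c + h]` with claimed enclosure `[zlo, zhi]`: `0 < S`, `0 < h`;
the point model of `p` at `c` accepted (`f(c)·S ∈ [Y̲, Ȳ]`); the model of the tangent program `T.deriv p` on `X`
accepted with `0 ∉ F′(X) = [D̲, D̄]/S`; the guard certificate of `p` on `X` (so that `Ṗ` IS the derivative); the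
Newton radius `r < h` (so `N(X) ⊆ [c − r, c + r] ⊆ X`: the existence test); and
`c − h < zlo ≤ c − r ≤ c + r ≤ zhi < c + h`. [cite: Moore1979, Sect. 5.2 Thm 5.5–5.6] [cite: AlefeldMayer2000, Sect. 3 Theorem 5] -/
def newtonLeafCheck (prm : M.Prm) (S : ℕ) (p : GProg M) (B : PBox) (c h : ℚ)
    (cs0 csd csg : List (List ℤ × ℕ)) (zlo zhi : ℚ) : Bool :=
  let Y := M.pointI prm S p B c cs0
  let W' := M.pmodelP prm S h c (T.deriv p) B csd
  let Dl := tlowerI S h W'.1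
  let Du := tupperI S h W'.1
  let r := newtonRad Y.1 Dl Du
  decide (0 < S) && decide (0 < h) && Y.2 && W'.2 && T.guardCheckP prm S h c p B csg &&
    (decide (0 < Dl) || decide (Du < 0)) && decide (r < h) && decide (zlo ≤ c - r) && decide (c + r ≤ zhi) &&
    decide (c - h < zlo) && decide (zhi < c + h)

end OpTangentCore

namespace OpTangent

variable {M : OpModel} {F : OpSem M} (T : OpTangent M F)

/-- **Soundness of the Newton leaf**: exactly one zero of `P(ps; ·)` in `[c − h, c + h]`, and every zero there
lies in the claimed enclosure `[zlo, zhi]`, strictly inside the leaf — for every parameter vector of the box.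
The interval Newton existence-and-uniqueness theorem `existsUnique_zero_of_newtonSet_subset` applied with the
derivative `Ṗ(ps; ·)` of the tangent program (`hasDerivAt_of_guardCheckP`), its model as `F′(X)`, and
`N(X) ⊆ [c − r, c + r]` (`newtonSet_subset_Icc`). [cite: Moore1979, Sect. 5.2 Thm 5.5–5.6] [cite: AlefeldMayer2000, Sect. 3 Theorem 5] -/
theorem existsUnique_zero_of_newtonLeafCheck {prm : M.Prm} {S : ℕ} {p : GProg M} {B : PBox} {c h : ℚ}
    {cs0 csd csg : List (List ℤ × ℕ)} {zlo zhi : ℚ}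
    (hc : T.newtonLeafCheck prm S p B c h cs0 csd csg zlo zhi = true) {ps : List ℝ} (hB : BoxMem ps B) :
    (∃! x, x ∈ Icc ((c : ℝ) - h) ((c : ℝ) + h) ∧ F.toFunP p ps x = 0) ∧
      ∀ x ∈ Icc ((c : ℝ) - h) ((c : ℝ) + h), F.toFunP p ps x = 0 →
        (((zlo : ℚ) : ℝ) ≤ x ∧ x ≤ ((zhi : ℚ) : ℝ)) ∧ ((c : ℝ) - h < x ∧ x < (c : ℝ) + h) := by
  unfold OpTangentCore.newtonLeafCheck at hc
  simp only [Bool.and_eq_true, Bool.or_eq_true, decide_eq_true_eq] at hc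
  obtain ⟨⟨⟨⟨⟨⟨⟨⟨⟨⟨hS, h0⟩, hok0⟩, hokd⟩, hg⟩, hsgn⟩, hrh⟩, hzlo⟩, hzhi⟩, hlo⟩, hhi⟩ := hc
  set f := F.toFunP p ps with hf
  set f' := F.toFunP (T.deriv p) ps with hf'
  set W' := (M.pmodelP prm S h c (T.deriv p) B csd).1 with hW'def
  set Dl := tlowerI S h W' with hDl
  set Du := tupperI S h W' with hDu
  set Y := (M.pointI prm S p B c cs0).1 with hYdef
  have hSr : (0 : ℝ) < S := by exact_mod_cast hS
  have hder : ∀ t ∈ Icc ((c : ℝ) - h) ((c : ℝ) + h), HasDerivAt f (f' t) t :=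
    T.hasDerivAt_of_guardCheckP hg hB
  have hWm : TMem S h (fun u => f' ((c : ℝ) + u)) W' := F.tmem_pmodelP prm hS h0.le c (T.deriv p) hB csd hokd
  -- the derivative enclosure `[Dl/S, Du/S]`
  have hD : ∀ t ∈ Icc ((c : ℝ) - h) ((c : ℝ) + h), f' t ∈ Icc ((Dl : ℝ) / S) ((Du : ℝ) / S) := by
    intro t ht
    have hu : |t - c| ≤ (h : ℝ) := abs_le.2 ⟨by linarith [ht.1], by linarith [ht.2]⟩
    have h1 := tlowerI_le h0.le hWm hu
    have h2 := le_tupperI h0.le hWm hu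
    have e : (c : ℝ) + (t - c) = t := by ring
    simp only [e] at h1 h2
    exact ⟨(div_le_iff₀ hSr).2 h1, (le_div_iff₀ hSr).2 h2⟩
  have hcm : (c : ℝ) ∈ Icc ((c : ℝ) - h) ((c : ℝ) + h) := by
    have : (0 : ℝ) < h := by exact_mod_cast h0
    exact ⟨by linarith, by linarith⟩
  have hDlDu : (Dl : ℝ) ≤ Du := by
    obtain ⟨h1, h2⟩ := hD c hcm
    have := h1.trans h2
    exact (div_le_div_iff_of_pos_right hSr).1 this
  have h0D : (0 : ℝ) ∉ Icc ((Dl : ℝ) / S) ((Du : ℝ) / S) := by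
    rintro ⟨h1, h2⟩
    rcases hsgn with hs | hs
    · have : (0 : ℝ) < Dl := by exact_mod_cast hs
      have : (0 : ℝ) < (Dl : ℝ) / S := div_pos this hSr
      linarith
    · have : (Du : ℝ) < 0 := by exact_mod_cast hs
      have : (Du : ℝ) / S < 0 := div_neg_of_neg_of_pos this hSr
      linarith
  -- magnitude data
  have hm0 : (0 : ℝ) < ((min |Dl| |Du| : ℤ) : ℝ) := by
    push_cast
    rcases hsgn with hs | hs
    · have h1 : (0 : ℝ) < Dl := by exact_mod_cast hs
      exact lt_min (abs_pos.2 (ne_of_gt h1)) (abs_pos.2 (ne_of_gt (lt_of_lt_of_le h1 hDlDu)))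
    · have h1 : (Du : ℝ) < 0 := by exact_mod_cast hs
      exact lt_min (abs_pos.2 (ne_of_lt (lt_of_le_of_lt hDlDu h1))) (abs_pos.2 (ne_of_lt h1))
  have hDabs : ∀ d ∈ Icc ((Dl : ℝ) / S) ((Du : ℝ) / S), ((min |Dl| |Du| : ℤ) : ℝ) ≤ |d| * S := by
    intro d hd
    exact le_abs_mul_of_mem ((div_le_iff₀ hSr).1 hd.1) ((le_div_iff₀ hSr).1 hd.2) hsgn
  have hY : |f c| * S ≤ ((max |Y.lo| |Y.hi| : ℤ) : ℝ) := abs_mul_le_of_mem (F.mem_pointI hS hok0 hB)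
  set r : ℚ := newtonRad Y Dl Du with hrdef
  have hrm : ((max |Y.lo| |Y.hi| : ℤ) : ℝ) ≤ (r : ℝ) * ((min |Dl| |Du| : ℤ) : ℝ) := by
    have hm0q : (0 : ℚ) < ((min |Dl| |Du| : ℤ) : ℚ) := by exact_mod_cast hm0
    have e : r * ((min |Dl| |Du| : ℤ) : ℚ) = ((max |Y.lo| |Y.hi| : ℤ) : ℚ) := by
      rw [hrdef, newtonRad, div_mul_cancel₀ _ (ne_of_gt hm0q)]
    have e' : (r : ℝ) * ((min |Dl| |Du| : ℤ) : ℝ) = ((max |Y.lo| |Y.hi| : ℤ) : ℝ) := by exact_mod_cast e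
    rw [e']
  have hN : newtonSet (c : ℝ) (f c) (Icc ((Dl : ℝ) / S) ((Du : ℝ) / S)) ⊆ Icc ((c : ℝ) - r) ((c : ℝ) + r) :=
    newtonSet_subset_Icc hY hm0 hDabs hrm
  have hrh' : (r : ℝ) < h := by exact_mod_cast hrh
  have hNX : newtonSet (c : ℝ) (f c) (Icc ((Dl : ℝ) / S) ((Du : ℝ) / S)) ⊆ Icc ((c : ℝ) - h) ((c : ℝ) + h) :=
    hN.trans (Icc_subset_Icc (by linarith) (by linarith))
  obtain ⟨heu, henc⟩ := existsUnique_zero_of_newtonSet_subset hder hD h0D hcm hNX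
  refine ⟨heu, fun x hx hx0 => ?_⟩
  have hxN := hN (henc x hx hx0)
  have hzlo' : ((zlo : ℚ) : ℝ) ≤ (c : ℝ) - r := by exact_mod_cast hzlo
  have hzhi' : (c : ℝ) + r ≤ ((zhi : ℚ) : ℝ) := by exact_mod_cast hzhi
  have hlo' : (c : ℝ) - h < ((zlo : ℚ) : ℝ) := by exact_mod_cast hlo
  have hhi' : ((zhi : ℚ) : ℝ) < (c : ℝ) + h := by exact_mod_cast hhi
  exact ⟨⟨hzlo'.trans hxN.1, hxN.2.trans hzhi'⟩, lt_of_lt_of_le hlo' (hzlo'.trans hxN.1),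
    lt_of_le_of_lt (hxN.2.trans hzhi') hhi'⟩

end OpTangent

/-! ### Part C. The zero-count certificate: leaves tiling `[a, b]` -/

/-- **Tiling**: the intervals `[cᵢ − hᵢ, cᵢ + hᵢ]` (given as pairs `(cᵢ, hᵢ)`, `hᵢ > 0`) tile `[x, y]` in order.
[cite: Kearfott1987, Sect. 1] [cite: MahboubiMelquiondSibutpinote2016, Sect. 3.3] -/
def tiles : ℚ → List (ℚ × ℚ) → ℚ → Bool
  | x, [], y => decide (x = y)
  | x, e :: R, y => decide (e.1 - e.2 = x) && decide (0 < e.2) && tiles (e.1 + e.2) R y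

/-- One step of the tiling. [cite: Kearfott1987, Sect. 1] -/
theorem tiles_cons (x : ℚ) (e : ℚ × ℚ) (R : List (ℚ × ℚ)) (y : ℚ) :
    tiles x (e :: R) y = (decide (e.1 - e.2 = x) && decide (0 < e.2) && tiles (e.1 + e.2) R y) := rfl

/-- A tiled interval is nondegenerate or a point: `x ≤ y`. [cite: Kearfott1987, Sect. 1] -/
theorem le_of_tiles : ∀ (x : ℚ) (R : List (ℚ × ℚ)) (y : ℚ), tiles x R y = true → x ≤ y
  | x, [], y, h => by simp only [tiles, decide_eq_true_eq] at h; exact h.le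
  | x, e :: R, y, h => by
      simp only [tiles, Bool.and_eq_true, decide_eq_true_eq] at h
      obtain ⟨⟨h1, h2⟩, h3⟩ := h
      have := le_of_tiles _ R y h3
      rw [← h1]; linarith

/-- **A leaf of a zero certificate**: the interval `[c − h, c + h]`; for an EXCLUSION leaf (`encl = none`) the
candidates `cs` of the model of `p` there; for a NEWTON leaf (`encl = some (zlo, zhi)`, the claimed enclosure of
its zero) the candidates `cs` of the POINT model of `p` at `c`, `csd` of the model of the tangent program and
`csg` of the guard certificate. [cite: Kearfott1987, Sect. 1] [cite: Moore1979, Sect. 5.2 Thm 5.5–5.6] -/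
structure ZLeaf : Type where
  /-- centre -/
  c : ℚ
  /-- half-width -/
  h : ℚ
  /-- candidates: model of `p` (exclusion) / point model of `p` (Newton) -/
  cs : List (List ℤ × ℕ)
  /-- candidates: model of the tangent program (Newton) -/
  csd : List (List ℤ × ℕ)
  /-- candidates: guard certificate (Newton) -/
  csg : List (List ℤ × ℕ)
  /-- `none`: exclusion leaf; `some (zlo, zhi)`: Newton leaf with its claimed enclosure -/
  encl : Option (ℚ × ℚ)
  deriving Repr, Inhabited

/-- The claimed enclosures of the Newton leaves, in order. [cite: Kearfott1987, Sect. 1] -/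
def zEncls : List ZLeaf → List (ℚ × ℚ)
  | [] => []
  | l :: L =>
      match l.encl with
      | none => zEncls L
      | some e => e :: zEncls L

/-- [folklore] -/
private theorem zEncls_cons (l : ZLeaf) (L : List ZLeaf) : zEncls (l :: L) = zEncls [l] ++ zEncls L := by
  cases hl : l.encl <;> simp [zEncls, hl]

namespace OpTangentCore

variable {M : OpModel} (T : OpTangentCore M)

/-- **The leaf check**: an exclusion leaf passes `M.exclLeafCheck`, a Newton leaf `T.newtonLeafCheck`.
[cite: Kearfott1987, Sect. 1] [cite: Moore1979, Sect. 5.2 Thm 5.5–5.6] -/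
def zLeafCheck (prm : M.Prm) (S : ℕ) (p : GProg M) (B : PBox) (l : ZLeaf) : Bool :=
  match l.encl with
  | none => M.exclLeafCheck prm S p B l.c l.h l.cs
  | some e => T.newtonLeafCheck prm S p B l.c l.h l.cs l.csd l.csg e.1 e.2

/-- Every leaf passes. [cite: Kearfott1987, Sect. 1] -/
def zLeavesCheck (prm : M.Prm) (S : ℕ) (p : GProg M) (B : PBox) : List ZLeaf → Bool
  | [] => true
  | l :: L => T.zLeafCheck prm S p B l && zLeavesCheck prm S p B L

/-- **The zero-count certificate** for `P(ps; ·)` on `[a, b]`, uniformly over the parameter box: the leaves are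
nonempty, tile `[a, b]` in order, and every leaf passes — then `P(ps; ·)` has EXACTLY one zero per Newton leaf on
`[a, b]`, each in its claimed enclosure, and no other (`OpTangent.zeros_of_zerosCheck`).
[cite: Kearfott1987, Sect. 1] [cite: Moore1979, Sect. 5.2 Thm 5.5–5.6] -/
def zerosCheck (prm : M.Prm) (S : ℕ) (p : GProg M) (B : PBox) (a b : ℚ) (L : List ZLeaf) : Bool :=
  !L.isEmpty && tiles a (L.map fun l => (l.c, l.h)) b && T.zLeavesCheck prm S p B L

end OpTangentCore

/-- **The zero-structure claim** on `[x, y]` against a list of enclosures `E`: the zeros of `f` in `[x, y]` ARE a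
strictly increasing list `zs`, in the open interval `(x, y)`, matched one-to-one and in order with `E`
(`zᵢ ∈ [Eᵢ.1, Eᵢ.2]`). [cite: Kearfott1987, Sect. 1] -/
def ZClaim (f : ℝ → ℝ) (x y : ℚ) (E : List (ℚ × ℚ)) : Prop :=
  ∃ zs : List ℝ, List.Forall₂ (fun (z : ℝ) (e : ℚ × ℚ) => ((e.1 : ℚ) : ℝ) ≤ z ∧ z ≤ ((e.2 : ℚ) : ℝ)) zs E ∧
    zs.Pairwise (· < ·) ∧ (∀ t : ℝ, (t ∈ Icc ((x : ℚ) : ℝ) ((y : ℚ) : ℝ) ∧ f t = 0) ↔ t ∈ zs) ∧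
      ∀ z ∈ zs, ((x : ℚ) : ℝ) < z ∧ z < ((y : ℚ) : ℝ)

namespace ZClaim

/-- [folklore] -/
private theorem forall₂_append {α β : Type} {R : α → β → Prop} :
    ∀ {l₁ : List α} {l₂ : List β} {l₃ : List α} {l₄ : List β},
      List.Forall₂ R l₁ l₂ → List.Forall₂ R l₃ l₄ → List.Forall₂ R (l₁ ++ l₃) (l₂ ++ l₄)
  | _, _, _, _, List.Forall₂.nil, h => h
  | _, _, _, _, List.Forall₂.cons h1 h2, h => List.Forall₂.cons h1 (forall₂_append h2 h)

/-- No zero on `[x, y]`: the claim with no enclosure. [cite: Kearfott1987, Sect. 1] -/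
theorem of_forall_ne {f : ℝ → ℝ} {x y : ℚ} (h : ∀ t ∈ Icc ((x : ℚ) : ℝ) ((y : ℚ) : ℝ), f t ≠ 0) :
    ZClaim f x y [] :=
  ⟨[], List.Forall₂.nil, List.Pairwise.nil, fun t => ⟨fun ht => (h t ht.1 ht.2).elim, fun ht => by simp at ht⟩,
    fun z hz => by simp at hz⟩

/-- Exactly one zero on `[x, y]`, inside `[zlo, zhi]` and the open interval: the claim with one enclosure.
[cite: Moore1979, Sect. 5.2 Thm 5.5–5.6] -/
theorem of_existsUnique {f : ℝ → ℝ} {x y zlo zhi : ℚ}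
    (heu : ∃! t, t ∈ Icc ((x : ℚ) : ℝ) ((y : ℚ) : ℝ) ∧ f t = 0)
    (henc : ∀ t ∈ Icc ((x : ℚ) : ℝ) ((y : ℚ) : ℝ), f t = 0 →
      (((zlo : ℚ) : ℝ) ≤ t ∧ t ≤ ((zhi : ℚ) : ℝ)) ∧ (((x : ℚ) : ℝ) < t ∧ t < ((y : ℚ) : ℝ))) :
    ZClaim f x y [(zlo, zhi)] := by
  obtain ⟨t0, ⟨ht0, hft0⟩, huniq⟩ := heu
  refine ⟨[t0], List.Forall₂.cons (henc t0 ht0 hft0).1 List.Forall₂.nil, List.pairwise_singleton _ _, fun t => ?_,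
    fun z hz => ?_⟩
  · constructor
    · intro ht; simp [huniq t ht]
    · intro ht
      simp only [List.mem_singleton] at ht
      rw [ht]; exact ⟨ht0, hft0⟩
  · simp only [List.mem_singleton] at hz
    rw [hz]; exact (henc t0 ht0 hft0).2

/-- **Gluing** the claims on `[x, m]` and `[m, y]` (`x ≤ m ≤ y`). [cite: Kearfott1987, Sect. 1] -/
theorem append {f : ℝ → ℝ} {x m y : ℚ} {E₁ E₂ : List (ℚ × ℚ)} (hxm : x ≤ m) (hmy : m ≤ y)
    (h₁ : ZClaim f x m E₁) (h₂ : ZClaim f m y E₂) : ZClaim f x y (E₁ ++ E₂) := by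
  obtain ⟨zs₁, hF₁, hS₁, hiff₁, hb₁⟩ := h₁
  obtain ⟨zs₂, hF₂, hS₂, hiff₂, hb₂⟩ := h₂
  have hxm' : ((x : ℚ) : ℝ) ≤ ((m : ℚ) : ℝ) := by exact_mod_cast hxm
  have hmy' : ((m : ℚ) : ℝ) ≤ ((y : ℚ) : ℝ) := by exact_mod_cast hmy
  refine ⟨zs₁ ++ zs₂, forall₂_append hF₁ hF₂, ?_, fun t => ?_, fun z hz => ?_⟩
  · rw [List.pairwise_append]
    exact ⟨hS₁, hS₂, fun a ha b hb => lt_trans (hb₁ a ha).2 (hb₂ b hb).1⟩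
  · rw [List.mem_append, ← hiff₁ t, ← hiff₂ t]
    constructor
    · rintro ⟨⟨ht1, ht2⟩, hft⟩
      rcases le_total t ((m : ℚ) : ℝ) with htm | htm
      · exact Or.inl ⟨⟨ht1, htm⟩, hft⟩
      · exact Or.inr ⟨⟨htm, ht2⟩, hft⟩
    · rintro (⟨⟨ht1, ht2⟩, hft⟩ | ⟨⟨ht1, ht2⟩, hft⟩)
      · exact ⟨⟨ht1, ht2.trans hmy'⟩, hft⟩
      · exact ⟨⟨hxm'.trans ht1, ht2⟩, hft⟩
  · rw [List.mem_append] at hz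
    rcases hz with hz | hz
    · exact ⟨(hb₁ z hz).1, lt_of_lt_of_le (hb₁ z hz).2 hmy'⟩
    · exact ⟨lt_of_le_of_lt hxm' (hb₂ z hz).1, (hb₂ z hz).2⟩

/-- The number of zeros is the number of enclosures. [cite: Kearfott1987, Sect. 1] -/
theorem ncard_eq {f : ℝ → ℝ} {x y : ℚ} {E : List (ℚ × ℚ)} (h : ZClaim f x y E) :
    {t : ℝ | t ∈ Icc ((x : ℚ) : ℝ) ((y : ℚ) : ℝ) ∧ f t = 0}.ncard = E.length := by
  obtain ⟨zs, hF, hS, hiff, -⟩ := h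
  have e : {t : ℝ | t ∈ Icc ((x : ℚ) : ℝ) ((y : ℚ) : ℝ) ∧ f t = 0} = ↑zs.toFinset := by
    ext t
    simp only [Set.mem_setOf_eq, List.coe_toFinset]
    exact hiff t
  rw [e, Set.ncard_coe_finset, List.toFinset_card_of_nodup hS.nodup, hF.length_eq]

/-- A zero claim with NO enclosure: `f` has no zero on `[x, y]`. [cite: Moore1979, Sect. 5.2 Thm 5.5–5.6] -/
theorem forall_ne_zero {f : ℝ → ℝ} {x y : ℚ} (h : ZClaim f x y []) :
    ∀ t ∈ Icc ((x : ℚ) : ℝ) ((y : ℚ) : ℝ), f t ≠ 0 := by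
  obtain ⟨zs, hF, -, hiff, -⟩ := h
  have hzs : zs = [] := by cases hF; rfl
  intro t ht hft
  have := (hiff t).1 ⟨ht, hft⟩
  rw [hzs] at this
  simp at this

/-- A zero claim with ONE enclosure: exactly one zero on `[x, y]`, inside the enclosure.
[cite: Moore1979, Sect. 5.2 Thm 5.5–5.6] [cite: AlefeldMayer2000, Sect. 3 Theorem 5] -/
theorem existsUnique {f : ℝ → ℝ} {x y zlo zhi : ℚ} (h : ZClaim f x y [(zlo, zhi)]) :
    (∃! t, t ∈ Icc ((x : ℚ) : ℝ) ((y : ℚ) : ℝ) ∧ f t = 0) ∧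
      ∀ t ∈ Icc ((x : ℚ) : ℝ) ((y : ℚ) : ℝ), f t = 0 → ((zlo : ℚ) : ℝ) ≤ t ∧ t ≤ ((zhi : ℚ) : ℝ) := by
  obtain ⟨zs, hF, -, hiff, -⟩ := h
  obtain ⟨z, hz, hzs⟩ : ∃ z : ℝ, (((zlo : ℚ) : ℝ) ≤ z ∧ z ≤ ((zhi : ℚ) : ℝ)) ∧ zs = [z] := by
    cases hF with
    | cons h1 h2 => cases h2; exact ⟨_, h1, rfl⟩
  subst hzs
  have hz0 := (hiff z).2 (by simp)
  refine ⟨⟨z, hz0, fun t ht => by simpa using (hiff t).1 ht⟩, fun t ht hft => ?_⟩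
  have := (hiff t).1 ⟨ht, hft⟩
  simp only [List.mem_singleton] at this
  rw [this]; exact hz

/-- A zero claim lists its zeros with their enclosures: the `i`-th zero (in increasing order) lies in the `i`-th
claimed interval. [cite: Kearfott1987, Sect. 1] -/
theorem forall₂_mem {f : ℝ → ℝ} {x y : ℚ} {E : List (ℚ × ℚ)} (h : ZClaim f x y E) :
    ∃ zs : List ℝ, List.Forall₂ (fun z e => ((e.1 : ℚ) : ℝ) ≤ z ∧ z ≤ ((e.2 : ℚ) : ℝ)) zs E ∧
      zs.Pairwise (· < ·) ∧ ∀ t, (t ∈ Icc ((x : ℚ) : ℝ) ((y : ℚ) : ℝ) ∧ f t = 0) ↔ t ∈ zs := by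
  obtain ⟨zs, hF, hS, hiff, -⟩ := h
  exact ⟨zs, hF, hS, hiff⟩

end ZClaim

namespace OpTangent

variable {M : OpModel} {F : OpSem M} (T : OpTangent M F)

/-- A passing leaf has positive half-width. [cite: Kearfott1987, Sect. 1] -/
theorem h_pos_of_zLeafCheck {prm : M.Prm} {S : ℕ} {p : GProg M} {B : PBox} {l : ZLeaf}
    (hc : T.zLeafCheck prm S p B l = true) : 0 < l.h := by
  unfold OpTangentCore.zLeafCheck at hc
  cases hl : l.encl with
  | none =>
      simp only [hl, OpModel.exclLeafCheck, Bool.and_eq_true, decide_eq_true_eq] at hc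
      exact hc.1.1.2
  | some e =>
      simp only [hl, OpTangentCore.newtonLeafCheck, Bool.and_eq_true, Bool.or_eq_true, decide_eq_true_eq] at hc
      exact hc.1.1.1.1.1.1.1.1.1.2

/-- **Soundness of one leaf**: the zero-structure claim on `[c − h, c + h]` against the leaf's enclosures.
[cite: Kearfott1987, Sect. 1] [cite: Moore1979, Sect. 5.2 Thm 5.5–5.6] -/
theorem zclaim_of_zLeafCheck {prm : M.Prm} {S : ℕ} {p : GProg M} {B : PBox} {l : ZLeaf}
    (hc : T.zLeafCheck prm S p B l = true) {ps : List ℝ} (hB : BoxMem ps B) :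
    ZClaim (F.toFunP p ps) (l.c - l.h) (l.c + l.h) (zEncls [l]) := by
  unfold OpTangentCore.zLeafCheck at hc
  cases hl : l.encl with
  | none =>
      simp only [hl] at hc
      have h1 := F.forall_ne_zero_of_exclLeafCheck hc hB
      simp only [zEncls, hl]
      refine ZClaim.of_forall_ne fun t ht => h1 t ?_
      push_cast at ht; exact ht
  | some e =>
      simp only [hl] at hc
      obtain ⟨heu, henc⟩ := T.existsUnique_zero_of_newtonLeafCheck hc hB
      simp only [zEncls, hl]
      refine ZClaim.of_existsUnique ?_ fun t ht hft => ?_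
      · push_cast; exact heu
      · push_cast at ht ⊢; exact henc t ht hft

/-- **Soundness along the chain** (nonempty list of leaves tiling `[x, y]`). [cite: Kearfott1987, Sect. 1] -/
theorem zclaim_of_zLeavesCheck {prm : M.Prm} {S : ℕ} {p : GProg M} {B : PBox} {ps : List ℝ} (hB : BoxMem ps B) :
    ∀ (L : List ZLeaf) (l : ZLeaf) (x y : ℚ), tiles x ((l :: L).map fun l => (l.c, l.h)) y = true →
      T.zLeavesCheck prm S p B (l :: L) = true → ZClaim (F.toFunP p ps) x y (zEncls (l :: L))
  | [], l, x, y, ht, hc => by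
      rw [List.map_cons, List.map_nil, tiles_cons] at ht
      simp only [tiles, Bool.and_eq_true, decide_eq_true_eq] at ht
      obtain ⟨⟨h1, -⟩, h3⟩ := ht
      simp only [OpTangentCore.zLeavesCheck, Bool.and_eq_true] at hc
      rw [← h1, ← h3]
      exact T.zclaim_of_zLeafCheck hc.1 hB
  | l' :: L, l, x, y, ht, hc => by
      rw [List.map_cons, tiles_cons] at ht
      simp only [Bool.and_eq_true, decide_eq_true_eq] at ht
      obtain ⟨⟨h1, h2⟩, h3⟩ := ht
      rw [OpTangentCore.zLeavesCheck, Bool.and_eq_true] at hc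
      have ih := zclaim_of_zLeavesCheck hB L l' (l.c + l.h) y h3 hc.2
      have hleaf := T.zclaim_of_zLeafCheck hc.1 hB
      rw [zEncls_cons, ← h1]
      exact ZClaim.append (by linarith) (le_of_tiles _ _ _ h3) hleaf ih

/-- **Soundness of the zero-count certificate.**  For every parameter vector of the box, the zeros of `P(ps; ·)`
on `[a, b]` ARE a strictly increasing list, one per Newton leaf and inside its claimed enclosure, in order.
[cite: Kearfott1987, Sect. 1] [cite: Moore1979, Sect. 5.2 Thm 5.5–5.6] -/
theorem zeros_of_zerosCheck {prm : M.Prm} {S : ℕ} {p : GProg M} {B : PBox} {a b : ℚ} {L : List ZLeaf}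
    (hc : T.zerosCheck prm S p B a b L = true) {ps : List ℝ} (hB : BoxMem ps B) :
    ZClaim (F.toFunP p ps) a b (zEncls L) := by
  unfold OpTangentCore.zerosCheck at hc
  simp only [Bool.and_eq_true, Bool.not_eq_true'] at hc
  obtain ⟨⟨hne, ht⟩, hl⟩ := hc
  match L, hne with
  | l :: L, _ => exact T.zclaim_of_zLeavesCheck hB L l a b ht hl

/-- **Exactly `|zEncls L|` zeros on `[a, b]`.** [cite: Kearfott1987, Sect. 1] -/
theorem ncard_zeros_of_zerosCheck {prm : M.Prm} {S : ℕ} {p : GProg M} {B : PBox} {a b : ℚ} {L : List ZLeaf}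
    (hc : T.zerosCheck prm S p B a b L = true) {ps : List ℝ} (hB : BoxMem ps B) :
    {t : ℝ | t ∈ Icc ((a : ℚ) : ℝ) ((b : ℚ) : ℝ) ∧ F.toFunP p ps t = 0}.ncard = (zEncls L).length :=
  (T.zeros_of_zerosCheck hc hB).ncard_eq

/-- **No zero on `[a, b]`** when the certificate has no Newton leaf. [cite: Moore1979, Sect. 5.2 Thm 5.5–5.6] -/
theorem forall_ne_zero_of_zerosCheck {prm : M.Prm} {S : ℕ} {p : GProg M} {B : PBox} {a b : ℚ} {L : List ZLeaf}
    (hc : T.zerosCheck prm S p B a b L = true) (hE : zEncls L = []) {ps : List ℝ} (hB : BoxMem ps B) :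
    ∀ t ∈ Icc ((a : ℚ) : ℝ) ((b : ℚ) : ℝ), F.toFunP p ps t ≠ 0 :=
  (hE ▸ T.zeros_of_zerosCheck hc hB).forall_ne_zero

/-- **Exactly one zero on `[a, b]`, enclosed**, when the certificate has one Newton leaf.
[cite: Moore1979, Sect. 5.2 Thm 5.5–5.6] [cite: AlefeldMayer2000, Sect. 3 Theorem 5] -/
theorem existsUnique_zero_of_zerosCheck {prm : M.Prm} {S : ℕ} {p : GProg M} {B : PBox} {a b : ℚ}
    {L : List ZLeaf} {zlo zhi : ℚ} (hc : T.zerosCheck prm S p B a b L = true) (hE : zEncls L = [(zlo, zhi)])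
    {ps : List ℝ} (hB : BoxMem ps B) :
    (∃! t, t ∈ Icc ((a : ℚ) : ℝ) ((b : ℚ) : ℝ) ∧ F.toFunP p ps t = 0) ∧
      ∀ t ∈ Icc ((a : ℚ) : ℝ) ((b : ℚ) : ℝ), F.toFunP p ps t = 0 → ((zlo : ℚ) : ℝ) ≤ t ∧ t ≤ ((zhi : ℚ) : ℝ) :=
  (hE ▸ T.zeros_of_zerosCheck hc hB).existsUnique

end OpTangent

/-! ### Part D. Inverse values of a monotone integral: `∃! x ∈ [A, B], ∫_A^x P(ps; t) dt = y` -/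

/-- **Inverse value of a strictly increasing primitive (slope form of the interval Newton test).**  If `f` is
integrable and positive on `[A, B]`, `f ≥ dl > 0` on `[c − r, c + r] ⊆ [A, B]`, and `|∫_A^c f − y| ≤ dl · r`, then
`G(x) = ∫_A^x f` takes the value `y` at exactly one point of `[A, B]`, which lies in `[c − r, c + r]`: the slope of
`G` on `[c − r, c + r]` is at least `dl`, so `N = c − (G(c) − y)/[slopes] ⊆ [c − r, c + r]` (existence by the
intermediate value theorem), and `G` is strictly increasing on `[A, B]` (uniqueness).
[cite: AlefeldMayer2000, Sect. 4] [cite: Moore1979, Sect. 5.2 Thm 5.5–5.6] -/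
theorem existsUnique_primitive_eq {f : ℝ → ℝ} {A B c r dl y : ℝ} (hfi : IntervalIntegrable f volume A B)
    (hpos : ∀ t ∈ Icc A B, 0 < f t) (hAc : A ≤ c - r) (hcB : c + r ≤ B)
    (hD : ∀ t ∈ Icc (c - r) (c + r), dl ≤ f t) (hdl : 0 < dl) (hE : |(∫ t in A..c, f t) - y| ≤ dl * r) :
    (∃! x, x ∈ Icc A B ∧ ∫ t in A..x, f t = y) ∧
      ∀ x ∈ Icc A B, ∫ t in A..x, f t = y → c - r ≤ x ∧ x ≤ c + r := by
  have hr : 0 ≤ r := by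
    have h1 : 0 ≤ dl * r := (abs_nonneg _).trans hE
    nlinarith
  have hAB : A ≤ B := by linarith
  set G : ℝ → ℝ := fun x => ∫ t in A..x, f t with hG
  have hsub : ∀ u v, u ∈ Icc A B → v ∈ Icc A B → IntervalIntegrable f volume u v := fun u v hu hv =>
    hfi.mono_set (by rw [uIcc_of_le hAB]; exact uIcc_subset_Icc hu hv)
  have hAI : A ∈ Icc A B := left_mem_Icc.2 hAB
  have hGdiff : ∀ u v, u ∈ Icc A B → v ∈ Icc A B → G v - G u = ∫ t in u..v, f t := fun u v hu hv =>
    integral_interval_sub_left (hsub A v hAI hv) (hsub A u hAI hu)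
  have hmono : ∀ u v, u ∈ Icc A B → v ∈ Icc A B → u < v → G u < G v := by
    intro u v hu hv huv
    have h1 := intervalIntegral_pos_of_pos_on (hsub u v hu hv)
      (fun t ht => hpos t ⟨hu.1.trans ht.1.le, ht.2.le.trans hv.2⟩) huv
    linarith [hGdiff u v hu hv]
  have hcont : ContinuousOn G (Icc A B) := by
    have h2 := continuousOn_primitive_interval' hfi (by rw [uIcc_of_le hAB]; exact hAI)
    rwa [uIcc_of_le hAB] at h2
  have hslope : ∀ u v, c - r ≤ u → u ≤ v → v ≤ c + r → dl * (v - u) ≤ G v - G u := by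
    intro u v hu huv hv
    have huI : u ∈ Icc A B := ⟨by linarith, by linarith⟩
    have hvI : v ∈ Icc A B := ⟨by linarith, by linarith⟩
    rw [hGdiff u v huI hvI]
    have h1 := integral_mono_on huv (f := fun _ => dl) (g := f) (μ := volume)
      (_root_.intervalIntegrable_const) (hsub u v huI hvI)
      (fun t ht => hD t ⟨by linarith [ht.1], by linarith [ht.2]⟩)
    rw [intervalIntegral.integral_const, smul_eq_mul] at h1
    linarith
  set E := G c - y with hEdef
  set xs := c - E / dl with hxs
  have hEb := abs_le.1 hE
  have hxs1 : c - r ≤ xs ∧ xs ≤ c + r := by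
    constructor
    · have : E / dl ≤ r := by rw [div_le_iff₀ hdl]; linarith [hEb.2]
      linarith
    · have : -r ≤ E / dl := by rw [le_div_iff₀ hdl]; linarith [hEb.1]
      linarith
  have hdl0 : dl ≠ 0 := ne_of_gt hdl
  have hex : ∃ x, (c - r ≤ x ∧ x ≤ c + r) ∧ G x = y := by
    rcases le_total xs c with hle | hle
    · have h1 : dl * (c - xs) ≤ G c - G xs := hslope xs c hxs1.1 hle (by linarith)
      have e1 : dl * (c - xs) = E := by
        rw [hxs, show c - (c - E / dl) = E / dl by ring, mul_comm, div_mul_cancel₀ _ hdl0]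
      have hy1 : G xs ≤ y := by linarith
      have hE0 : 0 ≤ E := by rw [← e1]; exact mul_nonneg hdl.le (by linarith)
      have hy2 : y ≤ G c := by linarith
      obtain ⟨x, hx, hGx⟩ := intermediate_value_Icc hle (hcont.mono (Icc_subset_Icc (by linarith) (by linarith)))
        ⟨hy1, hy2⟩
      exact ⟨x, ⟨by linarith [hx.1], by linarith [hx.2]⟩, hGx⟩
    · have h1 : dl * (xs - c) ≤ G xs - G c := hslope c xs (by linarith) hle hxs1.2
      have e1 : dl * (xs - c) = -E := by
        rw [hxs, show c - E / dl - c = (-E) / dl by ring, mul_comm, div_mul_cancel₀ _ hdl0]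
      have hy1 : y ≤ G xs := by linarith
      have hE0 : E ≤ 0 := by
        have : 0 ≤ dl * (xs - c) := mul_nonneg hdl.le (by linarith)
        linarith
      have hy2 : G c ≤ y := by linarith
      obtain ⟨x, hx, hGx⟩ := intermediate_value_Icc hle (hcont.mono (Icc_subset_Icc (by linarith) (by linarith)))
        ⟨hy2, hy1⟩
      exact ⟨x, ⟨by linarith [hx.1], by linarith [hx.2]⟩, hGx⟩
  obtain ⟨x0, hx0, hGx0⟩ := hex
  have hx0I : x0 ∈ Icc A B := ⟨by linarith [hx0.1], by linarith [hx0.2]⟩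
  have huniq : ∀ x ∈ Icc A B, G x = y → x = x0 := by
    intro x hx hGx
    rcases lt_trichotomy x x0 with h | h | h
    · have := hmono x x0 hx hx0I h; rw [hGx, hGx0] at this; exact (lt_irrefl _ this).elim
    · exact h
    · have := hmono x0 x hx0I hx h; rw [hGx, hGx0] at this; exact (lt_irrefl _ this).elim
  refine ⟨⟨x0, ⟨hx0I, hGx0⟩, fun x hx => huniq x hx.1 hx.2⟩, fun x hx hGx => ?_⟩
  rw [huniq x hx hGx]; exact hx0

/-- **A plain quadrature leaf**: the interval `[e − k, e + k]`, candidates of the model of `p` there, and the claimed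
scaled enclosure `[plo, phi]` of `S · ∫_{e−k}^{e+k} P(ps; t) dt`. [cite: MahboubiMelquiondSibutpinote2016, Sect. 3.3] -/
structure QLeaf : Type where
  /-- centre -/
  e : ℚ
  /-- half-width -/
  k : ℚ
  /-- certificate candidates of the leaf model -/
  cs : List (List ℤ × ℕ)
  /-- claimed scaled lower bound -/
  plo : ℤ
  /-- claimed scaled upper bound -/
  phi : ℤ
  deriving Repr, Inhabited

/-- Sum of the claimed lower bounds. [cite: MahboubiMelquiondSibutpinote2016, Sect. 3.3] -/
def qSumLo : List QLeaf → ℤ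
  | [] => 0
  | l :: L => l.plo + qSumLo L

/-- Sum of the claimed upper bounds. [cite: MahboubiMelquiondSibutpinote2016, Sect. 3.3] -/
def qSumHi : List QLeaf → ℤ
  | [] => 0
  | l :: L => l.phi + qSumHi L

/-- **A positivity leaf**: the interval `[e − k, e + k]` and candidates of the model of `p` there.
[cite: MakinoBerz2003, Algorithm 2] -/
structure PLeaf : Type where
  /-- centre -/
  e : ℚ
  /-- half-width -/
  k : ℚ
  /-- certificate candidates of the leaf model -/
  cs : List (List ℤ × ℕ)
  deriving Repr, Inhabited

/-- **A plain leaf segment from a Taylor model** (arbitrary centre `e` and half-width `k`): if `W` encloses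
`u ↦ f(e + u)` on `|u| ≤ k` for a measurable `f` and the kernel's panel enclosure `panelIntegI S k W (midPoly S W) [1]`
lies inside `[plo, phi]`, then `FSegOK f [1] S (e − k) (e + k) plo phi`.
[cite: MahboubiMelquiondSibutpinote2016, Sect. 3.2 Lemma 3] -/
theorem fsegOK_leaf_of_tmem {S : ℕ} (hS : 0 < S) {k : ℚ} (h0 : 0 < k) {f : ℝ → ℝ} (hf : Measurable f) (e : ℚ)
    {W : IPoly} (hW : TMem S k (fun u => f ((e : ℝ) + u)) W) {plo phi : ℤ}
    (hlo : plo ≤ (panelIntegI S k W (midPoly S W) [1]).lo) (hhi : (panelIntegI S k W (midPoly S W) [1]).hi ≤ phi) :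
    FSegOK f [1] S (e - k) (e + k) plo phi := by
  have hfi : IntervalIntegrable (fun u => f ((e : ℝ) + u)) volume (-(k : ℝ)) k :=
    intervalIntegrable_of_tmem hS h0.le hW (hf.comp (measurable_const.add measurable_id))
  have hm := mem_panelIntegI hS h0.le hW hfi (midPoly S W) [1]
  have e1 : -(k : ℝ) + (e : ℝ) = ((e - k : ℚ) : ℝ) := by push_cast; ring
  have e2 : (k : ℝ) + (e : ℝ) = ((e + k : ℚ) : ℝ) := by push_cast; ring
  have hq : ∀ t : ℝ, Poly.eval [1] t = 1 := fun t => by simp [Poly.eval_cons, Poly.eval_nil]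
  have hI : IntervalIntegrable (fun t => f t * Poly.eval [1] t) volume ((e - k : ℚ) : ℝ) ((e + k : ℚ) : ℝ) := by
    have h1 := hfi.comp_sub_right ((e : ℝ))
    have e0 : (fun x => f ((e : ℝ) + (x - (e : ℝ)))) = f := by funext x; congr 1; ring
    rw [e0, e1, e2] at h1
    simp_rw [hq, mul_one]; exact h1
  have eI : ∫ u in (-(k : ℝ))..k, f ((e : ℝ) + u) * Poly.eval [1] u =
      ∫ t in ((e - k : ℚ) : ℝ)..((e + k : ℚ) : ℝ), f t * Poly.eval [1] t := by
    simp_rw [hq, mul_one]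
    have hs := intervalIntegral.integral_comp_add_left (fun t => f t) ((e : ℝ)) (a := -(k : ℝ)) (b := k)
    rw [hs, ← e1, ← e2]
    congr 1 <;> ring
  rw [eI] at hm
  obtain ⟨hm1, hm2⟩ := hm
  have hloR : ((plo : ℤ) : ℝ) ≤ ((panelIntegI S k W (midPoly S W) [1]).lo : ℝ) := by exact_mod_cast hlo
  have hhiR : ((panelIntegI S k W (midPoly S W) [1]).hi : ℝ) ≤ ((phi : ℤ) : ℝ) := by exact_mod_cast hhi
  refine ⟨?_, ?_, hI⟩
  · rw [mul_comm]; exact hloR.trans hm1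
  · rw [mul_comm]; exact hm2.trans hhiR

/-- The empty segment. [cite: MahboubiMelquiondSibutpinote2016, Sect. 3.3] -/
theorem fsegOK_refl (f : ℝ → ℝ) (q : Poly) (S : ℕ) (x : ℚ) : FSegOK f q S x x 0 0 := by
  refine ⟨?_, ?_, IntervalIntegrable.refl⟩ <;> simp

namespace OpModel

variable (M : OpModel)

/-- **The quadrature-leaf check**: `0 < k`, the leaf model accepted, and the kernel's plain panel enclosure inside
`[plo, phi]`. [cite: MahboubiMelquiondSibutpinote2016, Sect. 3.2 Lemma 3] -/
def qLeafCheck (prm : M.Prm) (S : ℕ) (p : GProg M) (B : PBox) (l : QLeaf) : Bool :=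
  let W := M.pmodelP prm S l.k l.e p B l.cs
  let I := panelIntegI S l.k W.1 (midPoly S W.1) [1]
  decide (0 < l.k) && W.2 && decide (l.plo ≤ I.lo) && decide (I.hi ≤ l.phi)

/-- Every quadrature leaf passes. [cite: MahboubiMelquiondSibutpinote2016, Sect. 3.3] -/
def qLeavesCheck (prm : M.Prm) (S : ℕ) (p : GProg M) (B : PBox) : List QLeaf → Bool
  | [] => true
  | l :: L => M.qLeafCheck prm S p B l && qLeavesCheck prm S p B L

/-- **The positivity-leaf check**: `0 < k`, the leaf model accepted, and its scaled lower bound positive.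
[cite: MakinoBerz2003, Algorithm 2] -/
def pLeafCheck (prm : M.Prm) (S : ℕ) (p : GProg M) (B : PBox) (l : PLeaf) : Bool :=
  let W := M.pmodelP prm S l.k l.e p B l.cs
  decide (0 < l.k) && W.2 && decide (0 < tlowerI S l.k W.1)

/-- Every positivity leaf passes. [cite: MakinoBerz2003, Algorithm 2] -/
def pLeavesCheck (prm : M.Prm) (S : ℕ) (p : GProg M) (B : PBox) : List PLeaf → Bool
  | [] => true
  | l :: L => M.pLeafCheck prm S p B l && pLeavesCheck prm S p B L

/-- **The slope-Newton radius of the integral equation**: `max(|G̲ − yS|, |Ḡ − yS|) / D̲` for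
`G(c)·S ∈ [G̲, Ḡ]` and `P(ps; ·)·S ≥ D̲ > 0` near `c`. [cite: AlefeldMayer2000, Sect. 4] [cite: Moore1979, Sect. 5.2 (5.14)–(5.16)] -/
def invRad (S : ℕ) (Gl Gu : ℤ) (y : ℚ) (Dl : ℤ) : ℚ :=
  max |((Gl : ℤ) : ℚ) - y * S| |((Gu : ℤ) : ℚ) - y * S| / ((Dl : ℤ) : ℚ)

/-- **The integral-inverse certificate** for `∃! x ∈ [A, B], ∫_A^x P(ps; t) dt = y` with `x ∈ [zlo, zhi]`,
uniformly over the parameter box: `0 < S`, `0 < h`; the model of `p` on `[c − h, c + h]` accepted with `D̲ > 0`;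
the quadrature leaves tile `[A, c]` and pass (`G(c)·S ∈ [ΣG̲, ΣḠ]`); the positivity leaves tile `[A, B]` and pass;
the slope-Newton radius `r ≤ h`; `A ≤ c − h`, `c + h ≤ B`; `zlo ≤ c − r`, `c + r ≤ zhi`.
[cite: AlefeldMayer2000, Sect. 4] [cite: Moore1979, Sect. 5.2 Thm 5.5–5.6] [cite: MahboubiMelquiondSibutpinote2016, Sect. 3.3] -/
def invCertCheck (prm : M.Prm) (S : ℕ) (p : GProg M) (B : PBox) (A B' y c h : ℚ) (cs : List (List ℤ × ℕ))
    (Q : List QLeaf) (P : List PLeaf) (zlo zhi : ℚ) : Bool :=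
  let W := M.pmodelP prm S h c p B cs
  let Dl := tlowerI S h W.1
  let r := invRad S (qSumLo Q) (qSumHi Q) y Dl
  decide (0 < S) && decide (0 < h) && W.2 && decide (0 < Dl) &&
    tiles A (Q.map fun l => (l.e, l.k)) c && M.qLeavesCheck prm S p B Q &&
    tiles A (P.map fun l => (l.e, l.k)) B' && M.pLeavesCheck prm S p B P &&
    decide (r ≤ h) && decide (A ≤ c - h) && decide (c + h ≤ B') && decide (zlo ≤ c - r) && decide (c + r ≤ zhi)

end OpModel

namespace OpSem

variable {M : OpModel} (F : OpSem M)

/-- **Soundness of a quadrature leaf.** [cite: MahboubiMelquiondSibutpinote2016, Sect. 3.2 Lemma 3, Sect. 4.1] -/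
theorem fsegOK_of_qLeafCheck {prm : M.Prm} {S : ℕ} (hS : 0 < S) {p : GProg M} {B : PBox} {l : QLeaf}
    (hc : M.qLeafCheck prm S p B l = true) {ps : List ℝ} (hB : BoxMem ps B) :
    FSegOK (F.toFunP p ps) [1] S (l.e - l.k) (l.e + l.k) l.plo l.phi := by
  unfold OpModel.qLeafCheck at hc
  simp only [Bool.and_eq_true, decide_eq_true_eq] at hc
  obtain ⟨⟨⟨h0, hok⟩, hlo⟩, hhi⟩ := hc
  exact fsegOK_leaf_of_tmem hS h0 (F.measurable_toFunPZ p ps) l.e (F.tmem_pmodelP prm hS h0.le l.e p hB l.cs hok)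
    hlo hhi

/-- **Soundness of the quadrature leaves along a tiling**: the glued segment over `[x, c]` with the summed bounds.
[cite: MahboubiMelquiondSibutpinote2016, Sect. 3.3] -/
theorem fsegOK_of_qLeavesCheck {prm : M.Prm} {S : ℕ} (hS : 0 < S) {p : GProg M} {B : PBox} {ps : List ℝ}
    (hB : BoxMem ps B) : ∀ (Q : List QLeaf) (x c : ℚ), tiles x (Q.map fun l => (l.e, l.k)) c = true →
      M.qLeavesCheck prm S p B Q = true → FSegOK (F.toFunP p ps) [1] S x c (qSumLo Q) (qSumHi Q)
  | [], x, c, ht, _ => by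
      simp only [List.map_nil, tiles, decide_eq_true_eq] at ht
      subst ht
      exact fsegOK_refl _ _ _ _
  | l :: Q, x, c, ht, hc => by
      simp only [List.map_cons, tiles, Bool.and_eq_true, decide_eq_true_eq] at ht
      obtain ⟨⟨h1, -⟩, h3⟩ := ht
      rw [OpModel.qLeavesCheck, Bool.and_eq_true] at hc
      have ih := fsegOK_of_qLeavesCheck hS hB Q (l.e + l.k) c h3 hc.2
      have hleaf := F.fsegOK_of_qLeafCheck hS hc.1 hB
      rw [← h1, qSumLo, qSumHi]
      exact hleaf.append ih

/-- **Soundness of the positivity leaves along a tiling**: `P(ps; ·)` is interval integrable on `[x, y]` and positive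
on it (when `x < y`). [cite: MakinoBerz2003, Algorithm 2] [cite: MahboubiMelquiondSibutpinote2016, Sect. 3.3] -/
theorem pos_of_pLeavesCheck {prm : M.Prm} {S : ℕ} (hS : 0 < S) {p : GProg M} {B : PBox} {ps : List ℝ}
    (hB : BoxMem ps B) : ∀ (P : List PLeaf) (x y : ℚ), tiles x (P.map fun l => (l.e, l.k)) y = true →
      M.pLeavesCheck prm S p B P = true →
        IntervalIntegrable (F.toFunP p ps) volume ((x : ℚ) : ℝ) ((y : ℚ) : ℝ) ∧
          (x < y → ∀ t ∈ Icc ((x : ℚ) : ℝ) ((y : ℚ) : ℝ), 0 < F.toFunP p ps t)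
  | [], x, y, ht, _ => by
      simp only [List.map_nil, tiles, decide_eq_true_eq] at ht
      subst ht
      exact ⟨IntervalIntegrable.refl, fun h => (lt_irrefl _ h).elim⟩
  | l :: P, x, y, ht, hc => by
      simp only [List.map_cons, tiles, Bool.and_eq_true, decide_eq_true_eq] at ht
      obtain ⟨⟨h1, h2⟩, h3⟩ := ht
      rw [OpModel.pLeavesCheck, Bool.and_eq_true] at hc
      obtain ⟨ihI, ihP⟩ := pos_of_pLeavesCheck hS hB P (l.e + l.k) y h3 hc.2
      have hle := le_of_tiles _ _ _ h3
      have hcl := hc.1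
      unfold OpModel.pLeafCheck at hcl
      simp only [Bool.and_eq_true, decide_eq_true_eq] at hcl
      obtain ⟨⟨h0, hok⟩, hDl⟩ := hcl
      have hW := F.tmem_pmodelP prm hS h0.le l.e p hB l.cs hok
      have hfi : IntervalIntegrable (fun u => F.toFunP p ps ((l.e : ℝ) + u)) volume (-(l.k : ℝ)) l.k :=
        intervalIntegrable_of_tmem hS h0.le hW ((F.measurable_toFunPZ p ps).comp (measurable_const.add measurable_id))
      have hI : IntervalIntegrable (F.toFunP p ps) volume ((x : ℚ) : ℝ) (((l.e + l.k : ℚ)) : ℝ) := by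
        have h1' := hfi.comp_sub_right ((l.e : ℝ))
        have e0 : (fun t => F.toFunP p ps ((l.e : ℝ) + (t - (l.e : ℝ)))) = F.toFunP p ps := by
          funext t; congr 1; ring
        have e1 : -(l.k : ℝ) + (l.e : ℝ) = ((x : ℚ) : ℝ) := by rw [← h1]; push_cast; ring
        have e2 : (l.k : ℝ) + (l.e : ℝ) = ((l.e + l.k : ℚ) : ℝ) := by push_cast; ring
        rw [e0, e1, e2] at h1'
        exact h1'
      have hSr : (0 : ℝ) < S := by exact_mod_cast hS
      have hposleaf : ∀ t ∈ Icc ((x : ℚ) : ℝ) (((l.e + l.k : ℚ)) : ℝ), 0 < F.toFunP p ps t := by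
        intro t ht
        rw [← h1] at ht; push_cast at ht
        have hu : |t - l.e| ≤ (l.k : ℝ) := abs_le.2 ⟨by linarith [ht.1], by linarith [ht.2]⟩
        have h1' := tlowerI_le h0.le hW hu
        have e : (l.e : ℝ) + (t - l.e) = t := by ring
        rw [e] at h1'
        have hDl' : (0 : ℝ) < (tlowerI S l.k (M.pmodelP prm S l.k l.e p B l.cs).1 : ℝ) := by exact_mod_cast hDl
        have : 0 < F.toFunP p ps t * S := lt_of_lt_of_le hDl' h1'
        exact pos_of_mul_pos_left this hSr.le
      refine ⟨hI.trans ihI, fun _ t ht => ?_⟩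
      rcases le_or_gt t (((l.e + l.k : ℚ)) : ℝ) with htl | htl
      · exact hposleaf t ⟨ht.1, htl⟩
      · have hlt : l.e + l.k < y := by
          by_contra hge
          have hge' : y ≤ l.e + l.k := le_of_not_gt hge
          have : ((y : ℚ) : ℝ) ≤ ((l.e + l.k : ℚ) : ℝ) := by exact_mod_cast hge'
          linarith [ht.2]
        exact ihP hlt t ⟨htl.le, ht.2⟩

/-- **Soundness of the integral-inverse certificate**: for every parameter vector of the box,
`∃! x ∈ [A, B], ∫_A^x P(ps; t) dt = y`, and that `x` lies in `[zlo, zhi]`.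
[cite: AlefeldMayer2000, Sect. 4] [cite: Moore1979, Sect. 5.2 Thm 5.5–5.6] [cite: MahboubiMelquiondSibutpinote2016, Sect. 3.3, Sect. 4.1] -/
theorem existsUnique_integral_eq_of_invCertCheck {prm : M.Prm} {S : ℕ} {p : GProg M} {B : PBox}
    {A B' y c h : ℚ} {cs : List (List ℤ × ℕ)} {Q : List QLeaf} {P : List PLeaf} {zlo zhi : ℚ}
    (hc : M.invCertCheck prm S p B A B' y c h cs Q P zlo zhi = true) {ps : List ℝ} (hB : BoxMem ps B) :
    (∃! x, x ∈ Icc ((A : ℚ) : ℝ) ((B' : ℚ) : ℝ) ∧ ∫ t in ((A : ℚ) : ℝ)..x, F.toFunP p ps t = ((y : ℚ) : ℝ)) ∧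
      ∀ x ∈ Icc ((A : ℚ) : ℝ) ((B' : ℚ) : ℝ), ∫ t in ((A : ℚ) : ℝ)..x, F.toFunP p ps t = ((y : ℚ) : ℝ) →
        ((zlo : ℚ) : ℝ) ≤ x ∧ x ≤ ((zhi : ℚ) : ℝ) := by
  unfold OpModel.invCertCheck at hc
  simp only [Bool.and_eq_true, decide_eq_true_eq] at hc
  obtain ⟨⟨⟨⟨⟨⟨⟨⟨⟨⟨⟨⟨hS, h0⟩, hok⟩, hDl⟩, htQ⟩, hQ⟩, htP⟩, hP⟩, hrh⟩, hAc⟩, hcB⟩, hzlo⟩, hzhi⟩ := hc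
  set W := (M.pmodelP prm S h c p B cs).1 with hWdef
  set Dl := tlowerI S h W with hDldef
  set r := OpModel.invRad S (qSumLo Q) (qSumHi Q) y Dl with hrdef
  have hSr : (0 : ℝ) < S := by exact_mod_cast hS
  have h0r : (0 : ℝ) < h := by exact_mod_cast h0
  -- positivity and integrability on `[A, B']`
  have hAB : A < B' := by linarith
  obtain ⟨hfi, hposP⟩ := F.pos_of_pLeavesCheck hS hB P A B' htP hP
  have hpos := hposP hAB
  -- `G(c)·S ∈ [Gl, Gu]`
  have hseg := F.fsegOK_of_qLeavesCheck hS hB Q A c htQ hQ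
  obtain ⟨hG1, hG2, -⟩ := hseg
  have hq1 : ∀ t : ℝ, F.toFunP p ps t * Poly.eval [1] t = F.toFunP p ps t := fun t => by
    simp [Poly.eval_cons, Poly.eval_nil]
  simp only [hq1] at hG1 hG2
  set Gc := ∫ t in ((A : ℚ) : ℝ)..((c : ℚ) : ℝ), F.toFunP p ps t with hGc
  -- lower bound `dl = Dl/S` on `[c − h, c + h]`
  have hWm : TMem S h (fun u => F.toFunP p ps ((c : ℝ) + u)) W := F.tmem_pmodelP prm hS h0.le c p hB cs hok
  have hDlr : (0 : ℝ) < (Dl : ℝ) := by exact_mod_cast hDl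
  have hD : ∀ t ∈ Icc ((c : ℝ) - r) ((c : ℝ) + r), (Dl : ℝ) / S ≤ F.toFunP p ps t := by
    intro t ht
    have hrh' : (r : ℝ) ≤ h := by exact_mod_cast hrh
    have hu : |t - c| ≤ (h : ℝ) := abs_le.2 ⟨by linarith [ht.1], by linarith [ht.2]⟩
    have h1 := tlowerI_le h0.le hWm hu
    have e : (c : ℝ) + (t - c) = t := by ring
    simp only [e] at h1
    exact (div_le_iff₀ hSr).2 h1
  -- the residual bound `|Gc − y| ≤ (Dl/S) · r`
  have hE : |Gc - ((y : ℚ) : ℝ)| ≤ (Dl : ℝ) / S * r := by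
    have hE1 : |Gc - ((y : ℚ) : ℝ)| * S ≤
        ((max |((qSumLo Q : ℤ) : ℚ) - y * S| |((qSumHi Q : ℤ) : ℚ) - y * S| : ℚ) : ℝ) := by
      push_cast
      rw [← abs_of_pos hSr, ← abs_mul, abs_of_pos hSr, sub_mul]
      rcases le_total 0 (Gc * S - (y : ℝ) * S) with hs | hs
      · rw [abs_of_nonneg hs]
        refine le_trans ?_ (le_max_right _ _)
        refine le_trans ?_ (le_abs_self _)
        rw [mul_comm] at hG2; linarith
      · rw [abs_of_nonpos hs]
        refine le_trans ?_ (le_max_left _ _)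
        refine le_trans ?_ (neg_le_abs _)
        rw [mul_comm] at hG1; linarith
    have hDlq : (0 : ℚ) < ((Dl : ℤ) : ℚ) := by exact_mod_cast hDl
    have e : r * ((Dl : ℤ) : ℚ) = max |((qSumLo Q : ℤ) : ℚ) - y * S| |((qSumHi Q : ℤ) : ℚ) - y * S| := by
      rw [hrdef, OpModel.invRad, div_mul_cancel₀ _ (ne_of_gt hDlq)]
    have e' : (r : ℝ) * (Dl : ℝ) =
        ((max |((qSumLo Q : ℤ) : ℚ) - y * S| |((qSumHi Q : ℤ) : ℚ) - y * S| : ℚ) : ℝ) := by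
      exact_mod_cast e
    rw [← e'] at hE1
    rw [div_mul_eq_mul_div, le_div_iff₀ hSr]
    linarith
  have hAc' : ((A : ℚ) : ℝ) ≤ (c : ℝ) - r := by
    have : (r : ℝ) ≤ h := by exact_mod_cast hrh
    have : ((A : ℚ) : ℝ) ≤ (c : ℝ) - h := by exact_mod_cast hAc
    linarith
  have hcB' : (c : ℝ) + r ≤ ((B' : ℚ) : ℝ) := by
    have : (r : ℝ) ≤ h := by exact_mod_cast hrh
    have : (c : ℝ) + h ≤ ((B' : ℚ) : ℝ) := by exact_mod_cast hcB
    linarith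
  obtain ⟨heu, henc⟩ := existsUnique_primitive_eq hfi hpos hAc' hcB' hD (div_pos hDlr hSr) hE
  refine ⟨heu, fun x hx hGx => ?_⟩
  obtain ⟨h1, h2⟩ := henc x hx hGx
  have hzlo' : ((zlo : ℚ) : ℝ) ≤ (c : ℝ) - r := by exact_mod_cast hzlo
  have hzhi' : (c : ℝ) + r ≤ ((zhi : ℚ) : ℝ) := by exact_mod_cast hzhi
  exact ⟨hzlo'.trans h1, h2.trans hzhi'⟩

end OpSem

/-! ### Part E. Certificate generation (untrusted, outside the kernel; `#eval`) -/

namespace OpModel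

variable (M : OpModel)

/-- **The point value** `P(ps; c)` at scale `1` as read off the point model (midpoint of `pointI`; PROPOSAL only —
used to LOCATE zeros, never to certify them). [cite: MakinoBerz2003, Algorithm 2] -/
def pointVal (prm : M.Prm) (S : ℕ) (p : GProg M) (B : PBox) (c : ℚ) : ℚ :=
  let Y := (M.pointI prm S p B c []).1
  ((Y.lo + Y.hi : ℤ) : ℚ) / (2 * (S : ℚ))

/-- **Sign-change scan**: the cells of the uniform grid of `n` cells on `[a, b]` whose endpoint point values have
opposite signs (PROPOSAL only; a zero AT a grid point or a pair of zeros inside one cell is missed — the kernel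
then refuses the assembled certificate, nothing unsound). [cite: Kearfott1987, Sect. 1] -/
def scanCells (prm : M.Prm) (S : ℕ) (p : GProg M) (B : PBox) (a b : ℚ) (n : ℕ) : List (ℚ × ℚ) :=
  let w : ℚ := (b - a) / n
  let vs := (List.range (n + 1)).map fun i => (a + w * i, M.pointVal prm S p B (a + w * i))
  (vs.zip vs.tail).filterMap fun c => if c.1.2 * c.2.2 < 0 then some (c.1.1, c.2.1) else none

/-- **Bisection** on point values inside a sign-change cell `[x₀, x₁]`, `fuel` halvings; returns the final
midpoint, an approximate zero (PROPOSAL only). [cite: Kearfott1987, Sect. 1] -/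
def bisectRoot (prm : M.Prm) (S : ℕ) (p : GProg M) (B : PBox) : ℕ → ℚ → ℚ → ℚ
  | 0, x0, x1 => (x0 + x1) / 2
  | fuel + 1, x0, x1 =>
      let m := (x0 + x1) / 2
      if M.pointVal prm S p B x0 * M.pointVal prm S p B m ≤ 0 then bisectRoot prm S p B fuel x0 m
      else bisectRoot prm S p B fuel m x1

/-- **Adaptive exclusion tiling** of `[e − h, e + h]` by dyadic bisection (no certificate candidates): a leaf is
kept when `exclLeafCheck` accepts it, else halved; `fuel` bounds the depth (PROPOSAL only — every leaf is
re-checked by the kernel in `zerosCheck`). [cite: Kearfott1987, Sect. 1] [cite: Moore1979, Sect. 5.2 Thm 5.5–5.6] -/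
def exclAdapt (prm : M.Prm) (S : ℕ) (p : GProg M) (B : PBox) : ℕ → ℚ → ℚ → List ZLeaf × Bool
  | 0, e, h => ([⟨e, h, [], [], [], none⟩], M.exclLeafCheck prm S p B e h [])
  | fuel + 1, e, h =>
      if M.exclLeafCheck prm S p B e h [] then ([⟨e, h, [], [], [], none⟩], true)
      else
        let s := exclAdapt prm S p B fuel (e - h / 2) (h / 2)
        let t := exclAdapt prm S p B fuel (e + h / 2) (h / 2)
        (s.1 ++ t.1, s.2 && t.2)

/-- Exclusion tiling of a gap `[x, y]` between Newton leaves (empty when `x = y`, refused when `y < x`: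
overlapping Newton leaves). [cite: Kearfott1987, Sect. 1] -/
def exclGap (prm : M.Prm) (S : ℕ) (p : GProg M) (B : PBox) (fuel : ℕ) (x y : ℚ) : List ZLeaf × Bool :=
  if x = y then ([], true) else if y < x then ([], false)
  else M.exclAdapt prm S p B fuel ((x + y) / 2) ((y - x) / 2)

/-- **A quadrature leaf proposal** `[e − k, e + k]` with the kernel's own enclosure as the claimed one, and its
acceptance flag. [cite: MahboubiMelquiondSibutpinote2016, Sect. 3.3] -/
def qLeafOf (prm : M.Prm) (S : ℕ) (p : GProg M) (B : PBox) (e k : ℚ) (cs : List (List ℤ × ℕ)) : QLeaf × Bool :=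
  let W := M.pmodelP prm S k e p B cs
  let I := panelIntegI S k W.1 (midPoly S W.1) [1]
  (⟨e, k, cs, I.lo, I.hi⟩, decide (0 < k) && W.2)

/-- **Adaptive plain quadrature tiling** of `[e − k, e + k]`: a leaf is kept when accepted with claimed width at
most `tol · 2k` (at scale `1`), else halved; `fuel` bounds the depth (PROPOSAL only).
[cite: MahboubiMelquiondSibutpinote2016, Sect. 3.3] -/
def quadAdapt (prm : M.Prm) (S : ℕ) (p : GProg M) (B : PBox) (tol : ℚ) : ℕ → ℚ → ℚ → List QLeaf × Bool
  | 0, e, k =>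
      let r := M.qLeafOf prm S p B e k []
      ([r.1], r.2)
  | fuel + 1, e, k =>
      let r := M.qLeafOf prm S p B e k []
      if r.2 && decide (((r.1.phi - r.1.plo : ℤ) : ℚ) ≤ tol * (2 * k) * S) then ([r.1], true)
      else
        let s := quadAdapt prm S p B tol fuel (e - k / 2) (k / 2)
        let t := quadAdapt prm S p B tol fuel (e + k / 2) (k / 2)
        (s.1 ++ t.1, s.2 && t.2)

/-- The value of `∫_x^y P(ps; t) dt` (`x ≤ y`, else `0`) at scale `1` proposed by the adaptive tiling (midpoint
of the summed claims; PROPOSAL only — used to LOCATE `c`). [cite: MahboubiMelquiondSibutpinote2016, Sect. 3.3] -/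
def quadVal (prm : M.Prm) (S : ℕ) (p : GProg M) (B : PBox) (tol : ℚ) (fuel : ℕ) (x y : ℚ) : ℚ :=
  if y ≤ x then 0 else
    let Q := (M.quadAdapt prm S p B tol fuel ((x + y) / 2) ((y - x) / 2)).1
    ((qSumLo Q + qSumHi Q : ℤ) : ℚ) / (2 * (S : ℚ))

/-- Rounding to the dyadic grid `2^{-n} ℤ` (keeps the numerals of located centres small). [folklore] -/
private def roundDy (q : ℚ) (n : ℕ) : ℚ := ((round (q * 2 ^ n) : ℤ) : ℚ) / 2 ^ n

/-- **Locating the inverse value**: `k` Newton steps `c ← c − (G̃(c) − y)/P̃(ps; c)` on the proposals `quadVal`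
(for `G̃(c) ≈ ∫_A^c`) and `pointVal`, each iterate rounded to the grid `2^{-dy} ℤ` (PROPOSAL only).
[cite: AlefeldMayer2000, Sect. 4] -/
def invLocate (prm : M.Prm) (S : ℕ) (p : GProg M) (B : PBox) (tol : ℚ) (fuelQ dy : ℕ) (A y : ℚ) : ℕ → ℚ → ℚ
  | 0, c => c
  | k + 1, c =>
      let g := M.quadVal prm S p B tol fuelQ A c
      let d := M.pointVal prm S p B c
      invLocate prm S p B tol fuelQ dy A y k (roundDy (c - (g - y) / d) dy)

/-- **Adaptive positivity tiling** of `[e − k, e + k]`: a leaf is kept when `pLeafCheck` accepts it, else halved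
(PROPOSAL only). [cite: MakinoBerz2003, Algorithm 2] -/
def posAdapt (prm : M.Prm) (S : ℕ) (p : GProg M) (B : PBox) : ℕ → ℚ → ℚ → List PLeaf × Bool
  | 0, e, k => ([⟨e, k, []⟩], M.pLeafCheck prm S p B ⟨e, k, []⟩)
  | fuel + 1, e, k =>
      if M.pLeafCheck prm S p B ⟨e, k, []⟩ then ([⟨e, k, []⟩], true)
      else
        let s := posAdapt prm S p B fuel (e - k / 2) (k / 2)
        let t := posAdapt prm S p B fuel (e + k / 2) (k / 2)
        (s.1 ++ t.1, s.2 && t.2)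

/-- The data of an integral-inverse certificate proposal: `c`, `h`, the quadrature leaves of `[A, c]`, the
positivity leaves of `[A, B]`, the claimed enclosure. [cite: AlefeldMayer2000, Sect. 4] -/
structure InvCert : Type where
  /-- centre of the slope-Newton interval -/
  c : ℚ
  /-- its half-width -/
  h : ℚ
  /-- quadrature leaves tiling `[A, c]` -/
  Q : List QLeaf
  /-- positivity leaves tiling `[A, B]` -/
  P : List PLeaf
  /-- claimed lower end of the enclosure -/
  zlo : ℚ
  /-- claimed upper end of the enclosure -/
  zhi : ℚ
  deriving Repr, Inhabited

/-- **The assembled integral-inverse proposal** for `∫_A^x P(ps; t) dt = y`: locate `c` (`iters` Newton steps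
from `c0` on the grid `2^{-dy} ℤ`), tile `[A, c]` by quadrature leaves (claimed width `≤ tol` per unit length at
scale `1` — not below the rounding floor of a leaf, a few hundred units of `1/S` — depth `fuelQ`) and `[A, B]` by
positivity leaves (depth `fuelP`), take the slope-Newton interval of half-width `h` at `c`, claim `[c − r, c + r]`;
with the kernel's verdict on the proposal (PROPOSAL only). [cite: AlefeldMayer2000, Sect. 4] [cite: MahboubiMelquiondSibutpinote2016, Sect. 3.3] -/
def invGen (prm : M.Prm) (S : ℕ) (p : GProg M) (B : PBox) (A B' y c0 h tol : ℚ) (fuelQ fuelP iters dy : ℕ) :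
    InvCert × Bool :=
  let c := M.invLocate prm S p B tol fuelQ dy A y iters c0
  let Q := (M.quadAdapt prm S p B tol fuelQ ((A + c) / 2) ((c - A) / 2)).1
  let P := (M.posAdapt prm S p B fuelP ((A + B') / 2) ((B' - A) / 2)).1
  let W := M.pmodelP prm S h c p B []
  let r := invRad S (qSumLo Q) (qSumHi Q) y (tlowerI S h W.1)
  (⟨c, h, Q, P, c - r, c + r⟩, M.invCertCheck prm S p B A B' y c h [] Q P (c - r) (c + r))

end OpModel

namespace OpTangentCore

variable {M : OpModel} (T : OpTangentCore M)

/-- **A Newton leaf proposal** at centre `c` with half-width `h`: the claimed enclosure is the kernel's own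
`[c − r, c + r]`; with its acceptance flag (PROPOSAL only). [cite: Moore1979, Sect. 5.2 Thm 5.5–5.6] -/
def newtonLeafOf (prm : M.Prm) (S : ℕ) (p : GProg M) (B : PBox) (c h : ℚ) (cs0 csd csg : List (List ℤ × ℕ)) :
    ZLeaf × Bool :=
  let Y := M.pointI prm S p B c cs0
  let W' := M.pmodelP prm S h c (T.deriv p) B csd
  let r := newtonRad Y.1 (tlowerI S h W'.1) (tupperI S h W'.1)
  (⟨c, h, cs0, csd, csg, some (c - r, c + r)⟩, T.newtonLeafCheck prm S p B c h cs0 csd csg (c - r) (c + r))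

/-- The leaves from `x` to `b` given the located zeros `z₁ < z₂ < …` (no certificate candidates): exclusion tiling
of the gap up to `z₁ − hN`, the Newton leaf `[z₁ − hN, z₁ + hN]`, and so on (PROPOSAL only).
[cite: Kearfott1987, Sect. 1] -/
def zerosGenFrom (prm : M.Prm) (S : ℕ) (p : GProg M) (B : PBox) (fuelE : ℕ) (hN : ℚ) :
    ℚ → List ℚ → ℚ → List ZLeaf × Bool
  | x, [], b => M.exclGap prm S p B fuelE x b
  | x, z :: zs, b =>
      let g := M.exclGap prm S p B fuelE x (z - hN)
      let l := T.newtonLeafOf prm S p B z hN [] [] []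
      let rest := zerosGenFrom prm S p B fuelE hN (z + hN) zs b
      (g.1 ++ [l.1] ++ rest.1, g.2 && l.2 && rest.2)

/-- **The assembled zero-count proposal** for `P(ps; ·)` on `[a, b]`: zeros located by a sign-change scan over `n`
cells and `fuelB` bisection steps, a Newton leaf of half-width `hN` around each, exclusion tilings of depth
`≤ fuelE` in between; with the conjunction of the leaf verdicts (PROPOSAL only — the certificate is
`T.zerosCheck prm S p B a b L` on the returned `L`, decided by the kernel). [cite: Kearfott1987, Sect. 1] [cite: Moore1979, Sect. 5.2 Thm 5.5–5.6] -/
def zerosGen (prm : M.Prm) (S : ℕ) (p : GProg M) (B : PBox) (a b : ℚ) (n fuelB fuelE : ℕ) (hN : ℚ) :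
    List ZLeaf × Bool :=
  let cells := M.scanCells prm S p B a b n
  let roots := cells.map fun e => M.bisectRoot prm S p B fuelB e.1 e.2
  T.zerosGenFrom prm S p B fuelE hN a roots b

end OpTangentCore

end PolyMP

end Literature.Analysis.ValidatedNumerics
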